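import Summits.CriticalPhenomena.PercolationContinuityZ3.Theorems.Transplant.FKConnectivityAllQAntipodalOddConeLevel4All
import Summits.CriticalPhenomena.PercolationContinuityZ3.Theorems.Transplant.FKConnectivityAllQAntipodalValueThreshold
import HarnessLib

/-!
# Connectivity correlation inequalities for `φ_{w,q}`, every `q > 0` — file 74i: **THE VALUE LEVEL AT FOUR READ EDGES** — under `φ_{w,q}`
# (`0 < q ≤ 1`) on a weighted 2-connected series–parallel graph, every increasing event determined by at most four edges is negatively
# correlated with every increasing event not reading those edges

Support file (`--supports stmt-CriticalPhenomena-4575`), FK sub-lane `prim-bschramm-fk-2` (gen 33); builds on p205010 (kernel theorem,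
internal audit signed; external expert review pending).  No definitions, no named facts, no sorries; standard axioms.

File 74h (`FK.apPsiC_read4_nonpos_of_isTTSP`, gen 32) proved Conjecture `C_∞⁺`/`C_∞` at level 4 in the cells where the four read edges
`x, y, z, w` are LIVE and `x` is the root edge of the host.  This file moves that to an ARBITRARY cell and to the VALUE level:
* `FK.apPsiC_congr_right` — the cell functional only evaluates `g` at `γ ∪ C`, `γ ⊆ M` (bookkeeping);
* `FK.apPsiC_read4_live_nonpos_of_isTTSP` — any cell `(M, C)` of the host `H = E ∪ {st}` with the four distinct read pairs live
  (`x, y, z, w ∈ M`): Duffin re-rooting of `H` at `x` (`FK.IsTTSP.reroot_erase`) + file 74h;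
* `FK.apPsiC_read4_sub_nonpos_of_isTTSP` — ANY cell and any four distinct pairs wherever they sit (live, contracted, deleted or outside the
  host): if one of them is not live it is absorbed into `f` (`FK.apPsiC_read4_absorb_nonpos_of_isTTSP`, file 45e, then the three-pair
  theorem of file 45c), otherwise the live case;
* **`FK.rcMeasureW_read4_inter_le_of_isTTSP`** — `E` TTSP between `s, t`, `st ∉ E`, `w` vanishing off `H = E ∪ {st}` (an arbitrary
  weighted 2-connected series–parallel graph), `0 < q ≤ 1`, `A` an increasing event with `insert e ω ∈ A ↔ ω ∈ A` for every
  `e ∉ {x, y, z, w}`, `B` an increasing event with `insert e ω ∈ B ↔ ω ∈ B` for `e ∈ {x, y, z, w}` ⟹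
  `φ_{w,q}(A ∩ B) ≤ φ_{w,q}(A)·φ_{w,q}(B)` (gen 19's bridge `FK.rcMeasureW_real_inter_le_of_apPsiC_nonpos_on` sums the cells);
* `FK.rcMeasureW_t2_inter_le_of_isTTSP` — the instance `A = {ω_x ∧ (ω_y ∨ ω_z ∨ ω_w)} ∪ {ω_y ∧ ω_z ∧ ω_w}` (the `T2` ray of the
  level-4 odd cone, gens 29–32), against any increasing `B` off `x, y, z, w`.
So: negative association of the random-cluster measure with `q ≤ 1` on series–parallel graphs for all pairs of increasing events one of
which reads at most four edges — via the coefficientwise (`C_∞⁺`) route, i.e. together with the sign of every coefficient of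
`Z_H² Cov_{φ_{z,q}}(1_A, 1_B)` in the edge odds and in `q` (files 64h/74h), which the threshold route of gen 10
(`FK.negAssoc_threshold_of_noK4Minor`) does not give.
[cite: Grimmett2006, §1.4 eq. (1.20) (p. 15); §3.8 Thm. (3.90) (pp. 61–62); §3.9 (pp. 63–64)] [cite: Wagner2006, Thm. 5.8(d), §5.3]
-/

noncomputable section

namespace Summit.CriticalPhenomena.PercolationContinuityZ3.Theorems

namespace FK

open MeasureTheory Literature.Probability.LatticeModels Literature.Probability.Percolation
open Literature.Probability.Percolation.DecisionTree (ind ind_of_mem ind_of_not_mem)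
open scoped Classical

universe u

variable {V : Type u} [Fintype V] {s t : V}

/-! ### Bookkeeping -/

omit [Fintype V] in
/-- The cell functional only evaluates `g` at the arguments `γ ∪ C` and `(M \ γ) ∪ C`, `γ ⊆ M`. [folklore] -/
theorem apPsiC_congr_right (q : ℝ) {M C : Finset (Sym2 V)} (f : Finset (Sym2 V) → ℝ) {g₁ g₂ : Finset (Sym2 V) → ℝ}
    (h : ∀ γ : Finset (Sym2 V), γ ⊆ M → g₁ (γ ∪ C) = g₂ (γ ∪ C)) :
    apPsiC q M C f g₁ = apPsiC q M C f g₂ := by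
  unfold apPsiC
  refine Finset.sum_congr rfl fun γ hγ => ?_
  rw [h γ (Finset.mem_powerset.1 hγ), h (M \ γ) Finset.sdiff_subset]

omit [Fintype V] in
/-- A function not reading the pairs outside `R` takes equal values on sets with the same trace on `R`. [folklore] -/
theorem eq_of_notRead_outside_of_iff {f : Finset (Sym2 V) → ℝ} {R : Finset (Sym2 V)}
    (hf : ∀ e : Sym2 V, e ∉ R → ∀ A : Finset (Sym2 V), f (insert e A) = f A) (A B : Finset (Sym2 V))
    (hAB : ∀ e ∈ R, (e ∈ A ↔ e ∈ B)) : f A = f B := by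
  rw [eq_inter_of_notRead_outside hf A, eq_inter_of_notRead_outside hf B]
  congr 1
  ext e
  simp only [Finset.mem_inter]
  exact ⟨fun h => ⟨(hAB e h.2).1 h.1, h.2⟩, fun h => ⟨(hAB e h.2).2 h.1, h.2⟩⟩

/-! ### Four live read pairs, any cell -/

/-- **Any cell, four LIVE read pairs** (`0 < q ≤ 1`): `M, C ⊆ E ∪ {st}` disjoint, `x, y, z, w ∈ M` distinct, `f` increasing reading only
`x, y, z, w`, `g` increasing on the subsets of `M`, reading none of `x, y, z, w` nor the pairs of `C` ⟹ `apPsiC q M C f g ≤ 0`.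
Re-root the host at `x` (Duffin) and apply file 74h. [cite: Grimmett2006, §3.8 Thm. (3.90) (pp. 61–62); §3.9 (pp. 63–64)]
[cite: Wagner2006, Thm. 5.8(d), §5.3] -/
theorem apPsiC_read4_live_nonpos_of_isTTSP {q : ℝ} (hq0 : 0 < q) (hq1 : q ≤ 1) {E : Finset (Sym2 V)} (hE : IsTTSP E s t)
    (hst : s(s, t) ∉ E) {M C : Finset (Sym2 V)} (hM : M ⊆ insert s(s, t) E) (hC : C ⊆ insert s(s, t) E) (hMC : Disjoint M C)
    {x y z w : Sym2 V} (hx : x ∈ M) (hy : y ∈ M) (hz : z ∈ M) (hw : w ∈ M) (hxy : x ≠ y) (hxz : x ≠ z) (hxw : x ≠ w)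
    (hyz : y ≠ z) (hyw : y ≠ w) (hzw : z ≠ w) {f g : Finset (Sym2 V) → ℝ}
    (hf : ∀ e : Sym2 V, e ∉ ({x, y, z, w} : Finset (Sym2 V)) → ∀ A : Finset (Sym2 V), f (insert e A) = f A)
    (hfmono : ∀ ⦃A B : Finset (Sym2 V)⦄, A ⊆ B → f A ≤ f B)
    (hgx : ∀ A : Finset (Sym2 V), g (insert x A) = g A) (hgy : ∀ A : Finset (Sym2 V), g (insert y A) = g A)
    (hgz : ∀ A : Finset (Sym2 V), g (insert z A) = g A) (hgw : ∀ A : Finset (Sym2 V), g (insert w A) = g A)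
    (hgC : ∀ e ∈ C, ∀ A : Finset (Sym2 V), g (insert e A) = g A)
    (hmono : ∀ ⦃A B : Finset (Sym2 V)⦄, A ⊆ B → B ⊆ M → g A ≤ g B) :
    apPsiC q M C f g ≤ 0 := by
  induction x using Sym2.ind with
  | h a b =>
  -- re-root the host `H = E ∪ {st}` at `x = ab`
  set H : Finset (Sym2 V) := insert s(s, t) E with hHdef
  have hxH : s(a, b) ∈ H := hM hx
  have hR : IsTTSP (H.erase s(a, b)) a b := hE.reroot_erase hxH (insert_ne_singleton_of_isTTSP hE hst _)
  have hx' : s(a, b) ∉ H.erase s(a, b) := Finset.notMem_erase _ _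
  have hy' : y ∈ H.erase s(a, b) := Finset.mem_erase.2 ⟨fun h => hxy h.symm, hM hy⟩
  have hz' : z ∈ H.erase s(a, b) := Finset.mem_erase.2 ⟨fun h => hxz h.symm, hM hz⟩
  have hw' : w ∈ H.erase s(a, b) := Finset.mem_erase.2 ⟨fun h => hxw h.symm, hM hw⟩
  -- the free part of the cell without the four specials
  set M₀ : Finset (Sym2 V) := (((M.erase s(a, b)).erase y).erase z).erase w with hM₀def
  have hM₀M : M₀ ⊆ M := fun e he =>
    Finset.mem_of_mem_erase (Finset.mem_of_mem_erase (Finset.mem_of_mem_erase (Finset.mem_of_mem_erase he)))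
  have memM₀ : ∀ e : Sym2 V, e ∈ M₀ ↔ e ∈ M ∧ e ≠ s(a, b) ∧ e ≠ y ∧ e ≠ z ∧ e ≠ w := fun e => by
    simp only [hM₀def, Finset.mem_erase]
    tauto
  have hsub3 : ∀ X : Finset (Sym2 V), X ⊆ H → s(a, b) ∉ X → y ∉ X → z ∉ X → w ∉ X →
      X ⊆ (((H.erase s(a, b)).erase y).erase z).erase w := by
    intro X hX h1 h2 h3 h4 e he
    refine Finset.mem_erase.2 ⟨fun h => h4 (h ▸ he), Finset.mem_erase.2 ⟨fun h => h3 (h ▸ he),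
      Finset.mem_erase.2 ⟨fun h => h2 (h ▸ he), Finset.mem_erase.2 ⟨fun h => h1 (h ▸ he), hX he⟩⟩⟩⟩
  have hM₀ : M₀ ⊆ (((H.erase s(a, b)).erase y).erase z).erase w :=
    hsub3 M₀ (hM₀M.trans hM) (fun h => ((memM₀ _).1 h).2.1 rfl) (fun h => ((memM₀ _).1 h).2.2.1 rfl)
      (fun h => ((memM₀ _).1 h).2.2.2.1 rfl) (fun h => ((memM₀ _).1 h).2.2.2.2 rfl)
  have hC₀ : C ⊆ (((H.erase s(a, b)).erase y).erase z).erase w :=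
    hsub3 C hC (fun h => Finset.disjoint_left.1 hMC hx h) (fun h => Finset.disjoint_left.1 hMC hy h)
      (fun h => Finset.disjoint_left.1 hMC hz h) (fun h => Finset.disjoint_left.1 hMC hw h)
  have hM₀C : Disjoint M₀ C := Finset.disjoint_of_subset_left hM₀M hMC
  have hMeq : insert s(a, b) (insert y (insert z (insert w M₀))) = M := by
    ext e
    simp only [Finset.mem_insert, memM₀]
    constructor
    · rintro (rfl | rfl | rfl | rfl | h)
      · exact hx
      · exact hy
      · exact hz
      · exact hw
      · exact h.1
    · intro he
      by_cases h1 : e = s(a, b)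
      · exact Or.inl h1
      by_cases h2 : e = y
      · exact Or.inr (Or.inl h2)
      by_cases h3 : e = z
      · exact Or.inr (Or.inr (Or.inl h3))
      by_cases h4 : e = w
      · exact Or.inr (Or.inr (Or.inr (Or.inl h4)))
      exact Or.inr (Or.inr (Or.inr (Or.inr ⟨he, h1, h2, h3, h4⟩)))
  -- replace `g` by the globally increasing `X ↦ g (X ∩ M)` (the cell functional does not see the difference)
  have hgS : ∀ e ∈ ({s(a, b), y, z, w} : Finset (Sym2 V)), ∀ A : Finset (Sym2 V), g (insert e A) = g A := by
    intro e he A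
    simp only [Finset.mem_insert, Finset.mem_singleton] at he
    rcases he with rfl | rfl | rfl | rfl
    · exact hgx A
    · exact hgy A
    · exact hgz A
    · exact hgw A
  have hCM : C ∩ M = ∅ := Finset.disjoint_iff_inter_eq_empty.1 hMC.symm
  have hcong : apPsiC q M C f g = apPsiC q M C f (fun X => g (X ∩ M)) := by
    refine apPsiC_congr_right q f fun γ hγ => ?_
    show g (γ ∪ C) = g ((γ ∪ C) ∩ M)
    rw [Finset.union_inter_distrib_right, hCM, Finset.union_empty, Finset.inter_eq_left.2 hγ,
      notRead_union hgC C subset_rfl]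
  have hgU : ∀ A U : Finset (Sym2 V), U ⊆ ({s(a, b), y, z, w} : Finset (Sym2 V)) →
      (fun X => g (X ∩ M)) (A ∪ U) = (fun X => g (X ∩ M)) A := by
    intro A U hU
    show g ((A ∪ U) ∩ M) = g (A ∩ M)
    rw [Finset.union_inter_distrib_right]
    exact notRead_union hgS (U ∩ M) (Finset.inter_subset_left.trans hU) (A ∩ M)
  have hgM : ∀ ⦃X Y : Finset (Sym2 V)⦄, X ⊆ Y → (fun X => g (X ∩ M)) X ≤ (fun X => g (X ∩ M)) Y := by
    intro X Y hXY
    show g (X ∩ M) ≤ g (Y ∩ M)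
    exact hmono (Finset.inter_subset_inter hXY subset_rfl) Finset.inter_subset_right
  have key := apPsiC_read4_nonpos_of_isTTSP hq0.le hq1 hR hx' hy' hz' hw' hyz hyw hzw hM₀ hC₀ hM₀C
    (fun A B hAB => eq_of_notRead_outside_of_iff hf A B hAB) hfmono hgU hgM
  rw [hMeq] at key
  rw [hcong]
  exact key

/-! ### Four read pairs, any cell -/

/-- **Any cell, `f` reading four pairs wherever they sit** (`0 < q ≤ 1`): `M, C ⊆ E ∪ {st}` disjoint, `x, y, z, w` distinct pairs (live,
contracted, deleted, or even outside the host), `f` increasing reading only `x, y, z, w`, `g` increasing on the subsets of `M` reading none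
of `x, y, z, w` nor the pairs of `C` ⟹ `apPsiC q M C f g ≤ 0` — `C_∞` at level 4 in EVERY coefficient.
[cite: Grimmett2006, §3.8 Thm. (3.90) (pp. 61–62); §3.9 (pp. 63–64)] [cite: Wagner2006, Thm. 5.8(d), §5.3] -/
theorem apPsiC_read4_sub_nonpos_of_isTTSP {q : ℝ} (hq0 : 0 < q) (hq1 : q ≤ 1) {E : Finset (Sym2 V)} (hE : IsTTSP E s t)
    (hst : s(s, t) ∉ E) {M C : Finset (Sym2 V)} (hM : M ⊆ insert s(s, t) E) (hC : C ⊆ insert s(s, t) E) (hMC : Disjoint M C)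
    {x y z w : Sym2 V} (hxy : x ≠ y) (hxz : x ≠ z) (hxw : x ≠ w) (hyz : y ≠ z) (hyw : y ≠ w) (hzw : z ≠ w)
    {f g : Finset (Sym2 V) → ℝ}
    (hf : ∀ e : Sym2 V, e ∉ ({x, y, z, w} : Finset (Sym2 V)) → ∀ A : Finset (Sym2 V), f (insert e A) = f A)
    (hfmono : ∀ ⦃A B : Finset (Sym2 V)⦄, A ⊆ B → f A ≤ f B)
    (hgx : ∀ A : Finset (Sym2 V), g (insert x A) = g A) (hgy : ∀ A : Finset (Sym2 V), g (insert y A) = g A)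
    (hgz : ∀ A : Finset (Sym2 V), g (insert z A) = g A) (hgw : ∀ A : Finset (Sym2 V), g (insert w A) = g A)
    (hgC : ∀ e ∈ C, ∀ A : Finset (Sym2 V), g (insert e A) = g A)
    (hmono : ∀ ⦃A B : Finset (Sym2 V)⦄, A ⊆ B → B ⊆ M → g A ≤ g B) :
    apPsiC q M C f g ≤ 0 := by
  by_cases hwM : w ∈ M
  · by_cases hzM : z ∈ M
    · by_cases hyM : y ∈ M
      · by_cases hxM : x ∈ M
        · exact apPsiC_read4_live_nonpos_of_isTTSP hq0 hq1 hE hst hM hC hMC hxM hyM hzM hwM hxy hxz hxw hyz hyw hzw hf hfmono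
            hgx hgy hgz hgw hgC hmono
        · -- `x` not live: rotate so that `x` comes last and absorb it
          have hset : ({y, z, w, x} : Finset (Sym2 V)) = {x, y, z, w} := by
            ext e; simp only [Finset.mem_insert, Finset.mem_singleton]; tauto
          exact apPsiC_read4_absorb_nonpos_of_isTTSP hq0 hq1 hE hst hM hC hMC hyz hyw hzw hxM (hset ▸ hf) hfmono
            hgy hgz hgw hgC hmono
      · have hset : ({z, w, x, y} : Finset (Sym2 V)) = {x, y, z, w} := by
          ext e; simp only [Finset.mem_insert, Finset.mem_singleton]; tauto
        exact apPsiC_read4_absorb_nonpos_of_isTTSP hq0 hq1 hE hst hM hC hMC hzw hxz.symm hxw.symm hyM (hset ▸ hf) hfmono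
          hgz hgw hgx hgC hmono
    · have hset : ({w, x, y, z} : Finset (Sym2 V)) = {x, y, z, w} := by
        ext e; simp only [Finset.mem_insert, Finset.mem_singleton]; tauto
      exact apPsiC_read4_absorb_nonpos_of_isTTSP hq0 hq1 hE hst hM hC hMC hxw.symm hyw.symm hxy hzM (hset ▸ hf) hfmono
        hgw hgx hgy hgC hmono
  · exact apPsiC_read4_absorb_nonpos_of_isTTSP hq0 hq1 hE hst hM hC hMC hxy hxz hyz hwM hf hfmono hgx hgy hgz hgC hmono

/-! ### The value level -/

/-- **NEGATIVE CORRELATION AT THE VALUE LEVEL, four read edges** (`0 < q ≤ 1`).  `E` two-terminal series–parallel between `s, t`, `st ∉ E`,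
`w : Sym2 V → [0,1]` vanishing off `H = E ∪ {st}` (a weighted 2-connected series–parallel graph), `x, y, z, w'` distinct pairs; `A` an increasing
event reading only `x, y, z, w'` (`insert e ω ∈ A ↔ ω ∈ A` for `e ∉ {x,y,z,w'}`), `B` an increasing event reading none of `x, y, z, w'` ⟹
`φ_{w,q}(A ∩ B) ≤ φ_{w,q}(A)·φ_{w,q}(B)` — every coefficient of `Z_H² Cov_{φ_{z,q}}(1_A, 1_B)` is `≤ 0` (`FK.apPsiC_read4_sub_nonpos_of_isTTSP`)
and gen 19's bridge `FK.rcMeasureW_real_inter_le_of_apPsiC_nonpos_on` sums them.  With `FK.rcMeasureW_read3_inter_le_of_isTTSP` (file 45c)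
this is negative association on series–parallel graphs for every pair of increasing events one of which is determined by at most four edges.
[cite: Grimmett2006, §1.4 eq. (1.20) (p. 15); §3.8 Thm. (3.90) (pp. 61–62); §3.9 (pp. 63–64)] [cite: Wagner2006, Thm. 5.8(d), §5.3] -/
theorem rcMeasureW_read4_inter_le_of_isTTSP {q : ℝ} (hq0 : 0 < q) (hq1 : q ≤ 1) {E : Finset (Sym2 V)} (hE : IsTTSP E s t)
    (hst : s(s, t) ∉ E) (wt : Sym2 V → unitInterval) (hw : ∀ e, e ∉ insert s(s, t) E → ((wt e : ℝ)) = 0)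
    {x y z w : Sym2 V} (hxy : x ≠ y) (hxz : x ≠ z) (hxw : x ≠ w) (hyz : y ≠ z) (hyw : y ≠ w) (hzw : z ≠ w)
    (A B : Set (BondConfig V))
    (hA : ∀ (ω : BondConfig V) (e : Sym2 V), e ∉ ({x, y, z, w} : Finset (Sym2 V)) → (insert e ω ∈ A ↔ ω ∈ A))
    (hAmono : ∀ ω ω' : BondConfig V, ω ⊆ ω' → ω ∈ A → ω' ∈ A)
    (hBx : ∀ ω : BondConfig V, insert x ω ∈ B ↔ ω ∈ B) (hBy : ∀ ω : BondConfig V, insert y ω ∈ B ↔ ω ∈ B)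
    (hBz : ∀ ω : BondConfig V, insert z ω ∈ B ↔ ω ∈ B) (hBw : ∀ ω : BondConfig V, insert w ω ∈ B ↔ ω ∈ B)
    (hBmono : ∀ ω ω' : BondConfig V, ω ⊆ ω' → ω ∈ B → ω' ∈ B) :
    (rcMeasureW wt q ∅).real (A ∩ B) ≤ (rcMeasureW wt q ∅).real A * (rcMeasureW wt q ∅).real B := by
  refine rcMeasureW_real_inter_le_of_apPsiC_nonpos_on hq0 wt (insert s(s, t) E) hw A B fun σ S hSσ hσ hS => ?_
  have hSσd : Disjoint S σ := Finset.disjoint_of_subset_left hSσ Finset.sdiff_disjoint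
  -- indicator test functions on finite configurations
  have indI : ∀ (X : Set (BondConfig V)) (e : Sym2 V) (P : Finset (Sym2 V)),
      (insert e (↑P : BondConfig V) ∈ X ↔ (↑P : BondConfig V) ∈ X) → ind X (↑(insert e P) : BondConfig V) = ind X ↑P := by
    intro X e P h
    rw [Finset.coe_insert]
    by_cases hP : (↑P : BondConfig V) ∈ X
    · rw [ind_of_mem hP, ind_of_mem (h.2 hP)]
    · rw [ind_of_not_mem hP, ind_of_not_mem (fun h' => hP (h.1 h'))]
  have indM : ∀ (X : Set (BondConfig V)), (∀ ω ω' : BondConfig V, ω ⊆ ω' → ω ∈ X → ω' ∈ X) →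
      ∀ ⦃P Q : Finset (Sym2 V)⦄, P ⊆ Q → ind X (↑P : BondConfig V) ≤ ind X ↑Q := by
    intro X hX P Q hPQ
    by_cases hP : (↑P : BondConfig V) ∈ X
    · rw [ind_of_mem hP, ind_of_mem (hX _ _ (Finset.coe_subset.2 hPQ) hP)]
    · rw [ind_of_not_mem hP]
      by_cases hQ : (↑Q : BondConfig V) ∈ X
      · rw [ind_of_mem hQ]; exact zero_le_one
      · rw [ind_of_not_mem hQ]
  rw [apPsiC_right_union]
  refine apPsiC_read4_sub_nonpos_of_isTTSP hq0 hq1 hE hst hS hσ hSσd hxy hxz hxw hyz hyw hzw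
    (fun e he P => indI A e P (hA _ e he)) (indM A hAmono) (fun P => ?_) (fun P => ?_) (fun P => ?_) (fun P => ?_)
    (fun e he P => ?_) (fun P Q hPQ _ => indM B hBmono (Finset.union_subset_union hPQ le_rfl))
  · show ind B ↑(insert x P ∪ σ) = ind B ↑(P ∪ σ)
    rw [Finset.insert_union]; exact indI B x _ (hBx _)
  · show ind B ↑(insert y P ∪ σ) = ind B ↑(P ∪ σ)
    rw [Finset.insert_union]; exact indI B y _ (hBy _)
  · show ind B ↑(insert z P ∪ σ) = ind B ↑(P ∪ σ)
    rw [Finset.insert_union]; exact indI B z _ (hBz _)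
  · show ind B ↑(insert w P ∪ σ) = ind B ↑(P ∪ σ)
    rw [Finset.insert_union]; exact indI B w _ (hBw _)
  · show ind B ↑(insert e P ∪ σ) = ind B ↑(P ∪ σ)
    rw [Finset.insert_union, Finset.insert_eq_of_mem (Finset.mem_union_right _ he)]

/-- **The `T2` event of four edges, value level** (`0 < q ≤ 1`): under `φ_{w,q}` on a weighted 2-connected series–parallel graph, the event
`{ω_x ∧ (ω_y ∨ ω_z ∨ ω_w)} ∪ {ω_y ∧ ω_z ∧ ω_w}` (hub `x`; the `T2` ray of the level-4 odd cone, Conjecture `T2⁺` of gens 29–32, now a theorem)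
is negatively correlated with every increasing event `B` reading none of `x, y, z, w` (`FK.rcMeasureW_read4_inter_le_of_isTTSP`).
[cite: Grimmett2006, §3.8 Thm. (3.90) (pp. 61–62); §3.9 (pp. 63–64)] [cite: Wagner2006, Thm. 5.8(d), §5.3] -/
theorem rcMeasureW_t2_inter_le_of_isTTSP {q : ℝ} (hq0 : 0 < q) (hq1 : q ≤ 1) {E : Finset (Sym2 V)} (hE : IsTTSP E s t)
    (hst : s(s, t) ∉ E) (wt : Sym2 V → unitInterval) (hw : ∀ e, e ∉ insert s(s, t) E → ((wt e : ℝ)) = 0)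
    {x y z w : Sym2 V} (hxy : x ≠ y) (hxz : x ≠ z) (hxw : x ≠ w) (hyz : y ≠ z) (hyw : y ≠ w) (hzw : z ≠ w)
    (B : Set (BondConfig V))
    (hBx : ∀ ω : BondConfig V, insert x ω ∈ B ↔ ω ∈ B) (hBy : ∀ ω : BondConfig V, insert y ω ∈ B ↔ ω ∈ B)
    (hBz : ∀ ω : BondConfig V, insert z ω ∈ B ↔ ω ∈ B) (hBw : ∀ ω : BondConfig V, insert w ω ∈ B ↔ ω ∈ B)
    (hBmono : ∀ ω ω' : BondConfig V, ω ⊆ ω' → ω ∈ B → ω' ∈ B) :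
    (rcMeasureW wt q ∅).real ({ω : BondConfig V | (x ∈ ω ∧ (y ∈ ω ∨ z ∈ ω ∨ w ∈ ω)) ∨ (y ∈ ω ∧ z ∈ ω ∧ w ∈ ω)} ∩ B) ≤
      (rcMeasureW wt q ∅).real {ω : BondConfig V | (x ∈ ω ∧ (y ∈ ω ∨ z ∈ ω ∨ w ∈ ω)) ∨ (y ∈ ω ∧ z ∈ ω ∧ w ∈ ω)} *
        (rcMeasureW wt q ∅).real B := by
  refine rcMeasureW_read4_inter_le_of_isTTSP hq0 hq1 hE hst wt hw hxy hxz hxw hyz hyw hzw _ B (fun ω e he => ?_)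
    (fun ω ω' hωω' hω => ?_) hBx hBy hBz hBw hBmono
  · have hex : x ≠ e := fun h => he (h ▸ by simp)
    have hey : y ≠ e := fun h => he (h ▸ by simp)
    have hez : z ≠ e := fun h => he (h ▸ by simp)
    have hew : w ≠ e := fun h => he (h ▸ by simp)
    simp only [Set.mem_setOf_eq, Set.mem_insert_iff, hex, hey, hez, hew, false_or]
  · simp only [Set.mem_setOf_eq] at hω ⊢
    rcases hω with ⟨h1, h2 | h2 | h2⟩ | ⟨h1, h2, h3⟩
    · exact Or.inl ⟨hωω' h1, Or.inl (hωω' h2)⟩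
    · exact Or.inl ⟨hωω' h1, Or.inr (Or.inl (hωω' h2))⟩
    · exact Or.inl ⟨hωω' h1, Or.inr (Or.inr (hωω' h2))⟩
    · exact Or.inr ⟨hωω' h1, hωω' h2, hωω' h3⟩

end FK

end Summit.CriticalPhenomena.PercolationContinuityZ3.Theorems

end
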